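import Summits.RiemannHypothesis.RiemannHypothesis.Theorems.HandoffBumpAutocorr
import HarnessLib

/-!
# HANDOFF — the SYMMETRIC DIPOLE and the smoothed Chebyshev sum: Weil's form on a pair of far-apart bumps (cell rh-explicit, TRACK «HANDOFF», seat theory-2; file A of the kernel route to `WeilBottomDropOfOffLineZero`)

HONEST FRAMING. Nothing here proves or approaches RH; this is RH-free bookkeeping in the tree's normalisation, the first half
(idea-1's WEIL-BOTTOM-UNBOUNDED.md §2.1–2.2, checked by theory-1) of the kernel proof of theory-1's typed open lemma
`WeilBottomDropOfOffLineZero` (HANDOFF-STATEMENT §J.4: «an off-line zero makes the window bottom drop without bound»). For a smooth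
bump `ψ` centred at `0` with outer radius `r` and the SYMMETRIC PAIR `g_L(x) = ψ(x − L/2) + ψ(x + L/2)` (`L > 2r`; complexified):

* `‖g_L‖₂² = 2‖ψ‖₂²`, `tsupport g_L ⊆ [−(L/2 + r), L/2 + r]` (§1);
* its autocorrelation kernel is `k_{g_L} = 2φ + φ(· − L) + φ(· + L)`, `φ = ψ ⋆ ψ̃` (real, even, supported in `[−2r, 2r]`) (§2);
* Weil's functional on the far translate `φ(· ∓ L)`: polar term `(e^{L/2} + e^{−L/2})·φ̂(1)` EXACTLY (the main term `x^{1/2}Φ(½)`, `x = e^L`),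
  prime term `= Σ_n Λ(n) n^{−1/2} φ(log n − L)` EXACTLY (the `n^{−1/2}`-weighted Chebyshev sum smoothed by `φ` around `n ≈ x`; the mirrored
  atoms are invisible), archimedean term BOUNDED uniformly in `L` (on the critical line the translate is a modulation,
  `|e^{itL}| = 1`, and `∫‖ψ̂(½+it)‖²·|Re ψ(¼+it/2)| dt < ∞`) (§3);
* hence (§4) the INTERFACE inequality for file B:
  `ε(L/2 + r)·‖ψ‖₂² ≤ Re Q(ψ) + (e^{L/2} + e^{−L/2})·Re φ̂(1) − Re Σ_n Λ(n)n^{−1/2}φ(log n − L) + C_A(ψ)` for every `L > 2r`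
  (`weilGroundEnergy_mul_le_dipole`), `ε = weilGroundEnergy`, with the explicit `L`-independent constant
  `C_A(ψ) = (1/π)∫‖ψ̂(½+it)‖²(Re ψ(¼+it/2) + 2|Re ψ(¼)|) dt`.
  Read contrapositively: a LOWER bound on the window bottom `ε` is an UPPER bound on the smoothed `√x`-normalised Chebyshev sum
  beyond its main term — the input of Landau's oscillation argument (file B).

References: H. L. Montgomery, R. C. Vaughan, Multiplicative Number Theory I (2007) §15.1, proof of Thm 15.2 (the smoothed-Chebyshev /
Landau mechanism; `MontgomeryVaughan2007`); E. Bombieri, Rend. Mat. Acc. Lincei (9) 11 (2000) §3 (the hermitian form), §4 (`Bombieri2000Weil`).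
Split: §1–§2 (bump, pair, autocorrelation) live in `HandoffBumpAutocorr.lean` (file A1); this file = §3–§4, notations expanded
(the withdrawn p354701 carried the same content with `local notation`).
-/

set_option linter.dupNamespace false  -- the mandated namespace repeats `RiemannHypothesis`

noncomputable section

open Set Filter Complex MeasureTheory Literature.NumberTheory.LFunctions
open Literature.Analysis.SpecialFunctions (reDigammaQuarter)
open Summit.RiemannHypothesis.RiemannHypothesis.Theorems.Handoff
open Summit.RiemannHypothesis.RiemannHypothesis.Theorems.HandoffCapSharp
open Summit.RiemannHypothesis.RiemannHypothesis.Theorems.HandoffBumpAutocorr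
open scoped Real ComplexConjugate ArithmeticFunction.vonMangoldt

namespace Summit.RiemannHypothesis.RiemannHypothesis.Theorems.HandoffDipoleChebyshev

variable (ψ : ContDiffBump (0 : ℝ)) {L : ℝ}

/-! ## §3  Weil's functional on the far translate `φ(· − c)`, `|c| > 2r_out` -/

/-- `φ̂(0) = φ̂(1)` (`φ` even). [folklore] -/
theorem weilMellin_autocorr_zero : weilMellin (weilConv (fun x : ℝ ↦ ((ψ x : ℝ) : ℂ)) (weilReflect fun x : ℝ ↦ ((ψ x : ℝ) : ℂ))) 0 =
      weilMellin (weilConv (fun x : ℝ ↦ ((ψ x : ℝ) : ℂ)) (weilReflect fun x : ℝ ↦ ((ψ x : ℝ) : ℂ))) 1 := by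
  unfold weilMellin
  rw [← integral_neg_eq_self (fun t : ℝ ↦ (weilConv (fun x : ℝ ↦ ((ψ x : ℝ) : ℂ)) (weilReflect fun x : ℝ ↦ ((ψ x : ℝ) : ℂ))) t *
        cexp ((0 - 1 / 2) * (t : ℂ))) volume]
  congr 1 with t
  rw [autocorr_neg]
  congr 1
  push_cast
  ring_nf

/-- **Polar term of the translate**: `polar(φ(· − c)) = (e^{c/2} + e^{−c/2})·φ̂(1)` — the main term `x^{1/2}Φ(½)`, `x = e^{c}`.
[cite: MontgomeryVaughan2007, §15.1 (the main term of the smoothed Chebyshev sum)] -/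
theorem weilPolarTerm_translate (c : ℝ) :
    weilPolarTerm (weilTranslate (weilConv (fun x : ℝ ↦ ((ψ x : ℝ) : ℂ)) (weilReflect fun x : ℝ ↦ ((ψ x : ℝ) : ℂ))) c) = ((Real.exp
          (c / 2) + Real.exp (-(c / 2)) : ℝ) : ℂ) * weilMellin (weilConv (fun x : ℝ ↦ ((ψ x : ℝ) : ℂ)) (weilReflect fun x : ℝ ↦ ((ψ
          x : ℝ) : ℂ))) 1 := by
  unfold weilPolarTerm
  rw [weilMellin_weilTranslate, weilMellin_weilTranslate, weilMellin_autocorr_zero]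
  have e1 : cexp ((0 - 1 / 2) * (c : ℂ)) = ((Real.exp (-(c / 2)) : ℝ) : ℂ) := by
    rw [Complex.ofReal_exp]; congr 1; push_cast; ring
  have e2 : cexp ((1 - 1 / 2) * (c : ℂ)) = ((Real.exp (c / 2) : ℝ) : ℂ) := by
    rw [Complex.ofReal_exp]; congr 1; push_cast; ring
  rw [e1, e2]
  push_cast
  ring

/-- **Prime term of the translate** (`2r_out < c`): only the atoms `n` near `e^{c}` are seen —
`prime(φ(· − c)) = Σ_n Λ(n) n^{−1/2} φ(log n − c)`, the mirrored terms `φ(−log n − c)` vanishing. [folklore] -/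
theorem weilPrimeTerm_translate {c : ℝ} (hc : 2 * ψ.rOut < c) :
    weilPrimeTerm (weilTranslate (weilConv (fun x : ℝ ↦ ((ψ x : ℝ) : ℂ)) (weilReflect fun x : ℝ ↦ ((ψ x : ℝ) : ℂ))) c) =
      ∑' n : ℕ, ((Λ n : ℝ) : ℂ) / (Real.sqrt n : ℂ) * (weilConv (fun x : ℝ ↦ ((ψ x : ℝ) : ℂ)) (weilReflect fun x : ℝ ↦ ((ψ x : ℝ) :
            ℂ))) (Real.log n - c) := by
  unfold weilPrimeTerm weilTranslate
  congr 1 with n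
  have h0 : (weilConv (fun x : ℝ ↦ ((ψ x : ℝ) : ℂ)) (weilReflect fun x : ℝ ↦ ((ψ x : ℝ) : ℂ))) (-Real.log n - c) = 0 := by
    refine autocorr_eq_zero ψ ?_
    have hl : 0 ≤ Real.log n := Real.log_natCast_nonneg n
    have hr := ψ.rOut_pos
    rw [show -Real.log n - c = -(Real.log n + c) by ring, abs_neg, abs_of_nonneg (by linarith)]
    linarith
  rw [h0, add_zero]

/-- The mirrored translate sees the same atoms: `prime(φ(· + c)) = Σ_n Λ(n) n^{−1/2} φ(log n − c)` (`φ` even). [folklore] -/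
theorem weilPrimeTerm_translate_neg {c : ℝ} (hc : 2 * ψ.rOut < c) :
    weilPrimeTerm (weilTranslate (weilConv (fun x : ℝ ↦ ((ψ x : ℝ) : ℂ)) (weilReflect fun x : ℝ ↦ ((ψ x : ℝ) : ℂ))) (-c)) =
      ∑' n : ℕ, ((Λ n : ℝ) : ℂ) / (Real.sqrt n : ℂ) * (weilConv (fun x : ℝ ↦ ((ψ x : ℝ) : ℂ)) (weilReflect fun x : ℝ ↦ ((ψ x : ℝ) :
            ℂ))) (Real.log n - c) := by
  unfold weilPrimeTerm weilTranslate
  congr 1 with n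
  have hl : 0 ≤ Real.log n := Real.log_natCast_nonneg n
  have hr := ψ.rOut_pos
  have h0 : (weilConv (fun x : ℝ ↦ ((ψ x : ℝ) : ℂ)) (weilReflect fun x : ℝ ↦ ((ψ x : ℝ) : ℂ))) (Real.log n - -c) = 0 := by
    refine autocorr_eq_zero ψ ?_
    rw [sub_neg_eq_add, abs_of_nonneg (by linarith)]
    linarith
  rw [h0, zero_add, show -Real.log n - -c = -(Real.log n - c) by ring, autocorr_neg]

/-- On the critical line the transform of `φ` is `|ψ̂|²`: `‖φ̂(½ + it)‖ = ‖ψ̂(½ + it)‖²`. [folklore] -/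
theorem norm_weilMellin_autocorr_half (t : ℝ) :
    ‖weilMellin (weilConv (fun x : ℝ ↦ ((ψ x : ℝ) : ℂ)) (weilReflect fun x : ℝ ↦ ((ψ x : ℝ) : ℂ))) (1 / 2 + t * I)‖ = ‖weilMellin
          (fun x : ℝ ↦ ((ψ x : ℝ) : ℂ)) (1 / 2 + t * I)‖ ^ 2 := by
  have hψt := isWeilTest_bump ψ
  rw [weilMellin_weilConv_holds hψt.1.continuous hψt.2 hψt.weilReflect.1.continuous hψt.weilReflect.2,
    weilMellin_weilReflect_holds]
  have e : 1 - conj (1 / 2 + (t : ℂ) * I) = 1 / 2 + t * I := by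
    apply Complex.ext
    · simp only [Complex.sub_re, Complex.one_re, Complex.conj_re, Complex.add_re, Complex.mul_re, Complex.I_re,
        Complex.I_im, Complex.ofReal_re, Complex.ofReal_im, mul_zero, mul_one, sub_zero]
      norm_num
    · simp only [Complex.sub_im, Complex.one_im, Complex.conj_im, Complex.add_im, Complex.mul_im, Complex.I_re,
        Complex.I_im, Complex.ofReal_re, Complex.ofReal_im, mul_zero, mul_one, add_zero]
      norm_num
  rw [e, norm_mul, Complex.norm_conj, sq]

/-- The `L`-INDEPENDENT archimedean constant `C_A(ψ) = (1/π)∫‖ψ̂(½+it)‖²·(Re ψ(¼+it/2) + 2|Re ψ(¼)|) dt` is finite: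
the integrand is integrable. [folklore] -/
theorem integrable_archWeight :
    Integrable fun t : ℝ ↦ ‖weilMellin (fun x : ℝ ↦ ((ψ x : ℝ) : ℂ)) (1 / 2 + t * I)‖ ^ 2 * (reDigammaQuarter t + 2 * |reDigammaQuarter 0|) := by
  have h1 := integrable_norm_sq_weilMellin_mul_reDigammaQuarter (isWeilTest_bump ψ)
  have h2 := (integrable_norm_sq_weilMellin_half_line (isWeilTest_bump ψ)).mul_const (2 * |reDigammaQuarter 0|)
  have e : (fun t : ℝ ↦ ‖weilMellin (fun x : ℝ ↦ ((ψ x : ℝ) : ℂ)) (1 / 2 + t * I)‖ ^ 2 * (reDigammaQuarter t + 2 * |reDigammaQuarter 0|)) =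
      fun t : ℝ ↦ ‖weilMellin (fun x : ℝ ↦ ((ψ x : ℝ) : ℂ)) (1 / 2 + t * I)‖ ^ 2 * reDigammaQuarter t +
        ‖weilMellin (fun x : ℝ ↦ ((ψ x : ℝ) : ℂ)) (1 / 2 + t * I)‖ ^ 2 * (2 * |reDigammaQuarter 0|) := by
    funext t; ring
  rw [e]
  exact h1.add h2

/-- **Archimedean integral of the translate is bounded uniformly in `c`**: `‖∫ (φ(·−c))^(½+it) Re ψ(¼+it/2) dt‖ ≤ π·C_A(ψ)`
(translation = modulation by `e^{itc}` on the critical line; `|Re ψ(¼+it/2)| ≤ Re ψ(¼+it/2) + 2|Re ψ(¼)|` since `Re ψ(¼+it/2) ≥ Re ψ(¼)`).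
[folklore] -/
theorem norm_weilArchIntegral_translate_le (c : ℝ) :
    ‖weilArchIntegral (weilTranslate (weilConv (fun x : ℝ ↦ ((ψ x : ℝ) : ℂ)) (weilReflect fun x : ℝ ↦ ((ψ x : ℝ) : ℂ))) c)‖ ≤
      ∫ t : ℝ, ‖weilMellin (fun x : ℝ ↦ ((ψ x : ℝ) : ℂ)) (1 / 2 + t * I)‖ ^ 2 * (reDigammaQuarter t + 2 * |reDigammaQuarter 0|) := by
  unfold weilArchIntegral
  refine norm_integral_le_of_norm_le (integrable_archWeight ψ) (Eventually.of_forall fun t ↦ ?_)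
  rw [weilMellin_weilTranslate, norm_mul, norm_mul, norm_weilMellin_autocorr_half]
  have e : ‖cexp ((1 / 2 + (t : ℂ) * I - 1 / 2) * (c : ℂ))‖ = 1 := by
    rw [show (1 / 2 + (t : ℂ) * I - 1 / 2) * (c : ℂ) = ((t * c : ℝ) : ℂ) * I by push_cast; ring,
      Complex.norm_exp_ofReal_mul_I]
  rw [e, one_mul, Complex.norm_real, Real.norm_eq_abs]
  have hψ0 : reDigammaQuarter 0 ≤ reDigammaQuarter t :=
    Literature.Analysis.SpecialFunctions.reDigammaQuarter_zero_le t
  have habs : |reDigammaQuarter t| ≤ reDigammaQuarter t + 2 * |reDigammaQuarter 0| := by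
    rcases le_or_gt 0 (reDigammaQuarter t) with h | h
    · rw [abs_of_nonneg h]; linarith [abs_nonneg (reDigammaQuarter 0)]
    · rw [abs_of_neg h]; linarith [neg_abs_le (reDigammaQuarter 0)]
  have hre : (Complex.digamma (1 / 4 + (t : ℂ) / 2 * I)).re = reDigammaQuarter t := rfl
  rw [hre]
  exact mul_le_mul_of_nonneg_left habs (sq_nonneg _)

/-- Weil's archimedean term of the far translate has no `k(0)·log π` part (`φ(∓c) = 0`) and is bounded by `C_A(ψ)/2`:
`|Re W_∞(φ(· − c))| ≤ (1/2π)·∫‖ψ̂‖²(Re ψ + 2|Re ψ(¼)|)` for `2r_out < |c|`. [folklore] -/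
theorem abs_re_weilArchTerm_translate_le {c : ℝ} (hc : 2 * ψ.rOut < |c|) :
    |(weilArchTerm (weilTranslate (weilConv (fun x : ℝ ↦ ((ψ x : ℝ) : ℂ)) (weilReflect fun x : ℝ ↦ ((ψ x : ℝ) : ℂ))) c)).re| ≤
      1 / (2 * π) * ∫ t : ℝ, ‖weilMellin (fun x : ℝ ↦ ((ψ x : ℝ) : ℂ)) (1 / 2 + t * I)‖ ^ 2 * (reDigammaQuarter t + 2 * |reDigammaQuarter 0|) := by
  have h0 : weilTranslate (weilConv (fun x : ℝ ↦ ((ψ x : ℝ) : ℂ)) (weilReflect fun x : ℝ ↦ ((ψ x : ℝ) : ℂ))) c 0 = 0 := by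
    simp only [weilTranslate, zero_sub]
    exact autocorr_eq_zero ψ (by rwa [abs_neg])
  unfold weilArchTerm
  rw [h0, zero_mul, sub_zero]
  refine (Complex.abs_re_le_norm _).trans ?_
  rw [norm_mul, show ‖(1 / (2 * π) : ℂ)‖ = 1 / (2 * π) by
    rw [show (1 / (2 * π) : ℂ) = ((1 / (2 * π) : ℝ) : ℂ) by push_cast; ring, Complex.norm_real,
      Real.norm_of_nonneg (by positivity)]]
  exact mul_le_mul_of_nonneg_left (norm_weilArchIntegral_translate_le ψ c) (by positivity)

/-- **Weil's functional on the far translate, real part**: for `2r_out < |c|`,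
`Re W(φ(· − c)) ≤ (e^{c/2} + e^{−c/2})·Re φ̂(1) − Re Σ_n Λ(n)n^{−1/2}φ(log n − |c|) + C_A(ψ)/2`. [folklore] -/
theorem re_weilFunctional_translate_le {c : ℝ} (hc : 2 * ψ.rOut < c) (s : ℝ) (hs : s = c ∨ s = -c) :
    (weilFunctional (weilTranslate (weilConv (fun x : ℝ ↦ ((ψ x : ℝ) : ℂ)) (weilReflect fun x : ℝ ↦ ((ψ x : ℝ) : ℂ))) s)).re ≤
      (Real.exp (c / 2) + Real.exp (-(c / 2))) * (weilMellin (weilConv (fun x : ℝ ↦ ((ψ x : ℝ) : ℂ)) (weilReflect fun x : ℝ ↦ ((ψ x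
            : ℝ) : ℂ))) 1).re -
        (∑' n : ℕ, ((Λ n : ℝ) : ℂ) / (Real.sqrt n : ℂ) * (weilConv (fun x : ℝ ↦ ((ψ x : ℝ) : ℂ)) (weilReflect fun x : ℝ ↦ ((ψ x : ℝ)
              : ℂ))) (Real.log n - c)).re +
        1 / (2 * π) * ∫ t : ℝ, ‖weilMellin (fun x : ℝ ↦ ((ψ x : ℝ) : ℂ)) (1 / 2 + t * I)‖ ^ 2 * (reDigammaQuarter t + 2 * |reDigammaQuarter 0|) := by
  have hcpos : 0 < c := lt_of_le_of_lt (by linarith [ψ.rOut_pos]) hc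
  have hsabs : 2 * ψ.rOut < |s| := by
    rcases hs with rfl | rfl
    · rwa [abs_of_pos hcpos]
    · rwa [abs_neg, abs_of_pos hcpos]
  have harch := abs_re_weilArchTerm_translate_le ψ hsabs
  have hpol : (weilPolarTerm (weilTranslate (weilConv (fun x : ℝ ↦ ((ψ x : ℝ) : ℂ)) (weilReflect fun x : ℝ ↦ ((ψ x : ℝ) : ℂ)))
        s)).re = (Real.exp (c / 2) + Real.exp (-(c / 2))) * (weilMellin (weilConv (fun x : ℝ ↦ ((ψ x : ℝ) : ℂ)) (weilReflect fun x :
        ℝ ↦ ((ψ x : ℝ) : ℂ))) 1).re := by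
    rw [weilPolarTerm_translate, Complex.re_ofReal_mul]
    rcases hs with rfl | rfl
    · rfl
    · rw [show -c / 2 = -(c / 2) by ring, neg_neg, add_comm]
  have hpr : weilPrimeTerm (weilTranslate (weilConv (fun x : ℝ ↦ ((ψ x : ℝ) : ℂ)) (weilReflect fun x : ℝ ↦ ((ψ x : ℝ) : ℂ))) s) = ∑'
        n : ℕ, ((Λ n : ℝ) : ℂ) / (Real.sqrt n : ℂ) * (weilConv (fun x : ℝ ↦ ((ψ x : ℝ) : ℂ)) (weilReflect fun x : ℝ ↦ ((ψ x : ℝ) :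
        ℂ))) (Real.log n - c) := by
    rcases hs with rfl | rfl
    · exact weilPrimeTerm_translate ψ hc
    · exact weilPrimeTerm_translate_neg ψ hc
  unfold weilFunctional
  rw [Complex.add_re, Complex.sub_re, hpol, hpr]
  linarith [(abs_le.1 harch).2]

/-! ## §4  The interface inequality: the window bottom against the smoothed Chebyshev sum -/

/-- **Weil's form on the symmetric pair** (`2r_out < L`):
`Re Q(g_L) ≤ 2·Re Q(ψ) + 2(e^{L/2} + e^{−L/2})·Re φ̂(1) − 2·Re Σ_n Λ(n)n^{−1/2}φ(log n − L) + C_A(ψ)`.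
[cite: MontgomeryVaughan2007, §15.1 proof of Thm 15.2 (smoothed Chebyshev sum vs its main term); Bombieri2000Weil §3] -/
theorem re_weilQuadratic_symPair_le (hL : 2 * ψ.rOut < L) :
    (weilQuadratic (fun x : ℝ ↦ ((ψ (x - L / 2) + ψ (x + L / 2) : ℝ) : ℂ))).re ≤
      2 * (weilQuadratic (fun x : ℝ ↦ ((ψ x : ℝ) : ℂ))).re + 2 * ((Real.exp (L / 2) + Real.exp (-(L / 2))) * (weilMellin (weilConv
            (fun x : ℝ ↦ ((ψ x : ℝ) : ℂ)) (weilReflect fun x : ℝ ↦ ((ψ x : ℝ) : ℂ))) 1).re) -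
        2 * (∑' n : ℕ, ((Λ n : ℝ) : ℂ) / (Real.sqrt n : ℂ) * (weilConv (fun x : ℝ ↦ ((ψ x : ℝ) : ℂ)) (weilReflect fun x : ℝ ↦ ((ψ x
              : ℝ) : ℂ))) (Real.log n - L)).re +
        1 / π * ∫ t : ℝ, ‖weilMellin (fun x : ℝ ↦ ((ψ x : ℝ) : ℂ)) (1 / 2 + t * I)‖ ^ 2 * (reDigammaQuarter t + 2 * |reDigammaQuarter 0|) := by
  have hφt := isWeilTest_autocorr ψ
  have h1 := re_weilFunctional_translate_le ψ hL L (Or.inl rfl)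
  have h2 := re_weilFunctional_translate_le ψ hL (-L) (Or.inr rfl)
  -- Q(g_L) = W(2φ + φ_L + φ_{-L})
  have hk : weilConv (fun x : ℝ ↦ ((ψ (x - L / 2) + ψ (x + L / 2) : ℝ) : ℂ)) (weilReflect (fun x : ℝ ↦ ((ψ (x - L / 2) + ψ (x + L / 2) : ℝ) : ℂ))) =
      (fun x ↦ (2 : ℂ) * (weilConv (fun x : ℝ ↦ ((ψ x : ℝ) : ℂ)) (weilReflect fun x : ℝ ↦ ((ψ x : ℝ) : ℂ))) x) + (weilTranslate
            (weilConv (fun x : ℝ ↦ ((ψ x : ℝ) : ℂ)) (weilReflect fun x : ℝ ↦ ((ψ x : ℝ) : ℂ))) L + weilTranslate (weilConv (fun x :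
            ℝ ↦ ((ψ x : ℝ) : ℂ)) (weilReflect fun x : ℝ ↦ ((ψ x : ℝ) : ℂ))) (-L)) := by
    rw [weilConv_weilReflect_symPair]
    funext x
    simp only [Pi.add_apply, weilTranslate, sub_neg_eq_add]
  have h2φ : IsWeilTest (fun x ↦ (2 : ℂ) * (weilConv (fun x : ℝ ↦ ((ψ x : ℝ) : ℂ)) (weilReflect fun x : ℝ ↦ ((ψ x : ℝ) : ℂ))) x) := hφt.const_mul 2
  have hW : weilQuadratic (fun x : ℝ ↦ ((ψ (x - L / 2) + ψ (x + L / 2) : ℝ) : ℂ)) = 2 * weilFunctional (weilConv (fun x : ℝ ↦ ((ψ x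
        : ℝ) : ℂ)) (weilReflect fun x : ℝ ↦ ((ψ x : ℝ) : ℂ))) +
      (weilFunctional (weilTranslate (weilConv (fun x : ℝ ↦ ((ψ x : ℝ) : ℂ)) (weilReflect fun x : ℝ ↦ ((ψ x : ℝ) : ℂ))) L) +
            weilFunctional (weilTranslate (weilConv (fun x : ℝ ↦ ((ψ x : ℝ) : ℂ)) (weilReflect fun x : ℝ ↦ ((ψ x : ℝ) : ℂ))) (-L)))
            := by
    unfold weilQuadratic
    rw [hk, weilFunctional_add h2φ ((hφt.weilTranslate L).add (hφt.weilTranslate (-L))),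
      weilFunctional_add (hφt.weilTranslate L) (hφt.weilTranslate (-L)), weilFunctional_const_mul]
  have hQψ : weilFunctional (weilConv (fun x : ℝ ↦ ((ψ x : ℝ) : ℂ)) (weilReflect fun x : ℝ ↦ ((ψ x : ℝ) : ℂ))) = weilQuadratic (fun
        x : ℝ ↦ ((ψ x : ℝ) : ℂ)) := rfl
  rw [hW, hQψ]
  simp only [Complex.add_re, Complex.mul_re, Complex.re_ofNat, Complex.im_ofNat, zero_mul, sub_zero]
  have hπ : 1 / π = 2 * (1 / (2 * π)) := by field_simp
  rw [hπ]
  linarith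

/-- **THE INTERFACE INEQUALITY (file A ⟹ file B).** For every bump `ψ` at `0` of outer radius `r` and every `L > 2r`:
`ε(L/2 + r)·‖ψ‖₂² ≤ Re Q(ψ) + (e^{L/2} + e^{−L/2})·Re φ̂(1) − Re Σ_n Λ(n)n^{−1/2}φ(log n − L) + C_A(ψ)/2`,
`ε = weilGroundEnergy`, `φ = ψ ⋆ ψ̃`. So a lower bound `ε ≥ −C` on all windows bounds the smoothed `√x`-normalised Chebyshev
sum `Σ_n Λ(n)n^{−1/2}φ(log(n/x))` ABOVE by its main term `√x·φ̂(1)` plus a constant — the one-signed comparison function of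
Landau's lemma (file B). [cite: MontgomeryVaughan2007, §15.1 Lemma 15.1 / Thm 15.2 (mechanism); Bombieri2000Weil §4 Problem 2 (ε as an infimum)] -/
theorem weilGroundEnergy_mul_le_dipole (hL : 2 * ψ.rOut < L) :
    weilGroundEnergy (L / 2 + ψ.rOut) * ∫ y : ℝ, ψ y ^ 2 ≤
      (weilQuadratic (fun x : ℝ ↦ ((ψ x : ℝ) : ℂ))).re + (Real.exp (L / 2) + Real.exp (-(L / 2))) * (weilMellin (weilConv (fun x : ℝ
            ↦ ((ψ x : ℝ) : ℂ)) (weilReflect fun x : ℝ ↦ ((ψ x : ℝ) : ℂ))) 1).re -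
        (∑' n : ℕ, ((Λ n : ℝ) : ℂ) / (Real.sqrt n : ℂ) * (weilConv (fun x : ℝ ↦ ((ψ x : ℝ) : ℂ)) (weilReflect fun x : ℝ ↦ ((ψ x : ℝ)
              : ℂ))) (Real.log n - L)).re +
        1 / (2 * π) * ∫ t : ℝ, ‖weilMellin (fun x : ℝ ↦ ((ψ x : ℝ) : ℂ)) (1 / 2 + t * I)‖ ^ 2 * (reDigammaQuarter t + 2 * |reDigammaQuarter 0|) := by
  have hL0 : 0 ≤ L := by linarith [ψ.rOut_pos]
  have hgt := isWeilTest_symPair ψ (L := L)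
  have hgs : tsupport (fun x : ℝ ↦ ((ψ (x - L / 2) + ψ (x + L / 2) : ℝ) : ℂ)) ⊆ Icc (-(L / 2 + ψ.rOut)) (L / 2 + ψ.rOut) :=
    tsupport_symPair_subset ψ hL0 (by linarith)
  have hR : weilGroundEnergy (L / 2 + ψ.rOut) * ∫ u : ℝ, ‖((fun x : ℝ ↦ ((ψ (x - L / 2) + ψ (x + L / 2) : ℝ) : ℂ))) u‖ ^ 2 ≤
        (weilQuadratic (fun x : ℝ ↦ ((ψ (x - L / 2) + ψ (x + L / 2) : ℝ) : ℂ))).re := by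
    rw [weilGroundEnergy_eq_sInf]
    exact sInf_weilWindowSphereValues_mul_le_re hgt hgs fun _ _ ↦ trivial
  rw [integral_norm_sq_symPair ψ hL.le] at hR
  have hQ := re_weilQuadratic_symPair_le ψ hL
  have hπ : 1 / π = 2 * (1 / (2 * π)) := by field_simp
  rw [hπ] at hQ
  nlinarith [hR, hQ, integral_bump_sq_pos ψ]

end Summit.RiemannHypothesis.RiemannHypothesis.Theorems.HandoffDipoleChebyshev

end
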